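import Mathlib
import Summits.PneNP.PneNP.Theorems.ConvexRankGatesConvexGateBlindXorDefs
import Summits.PneNP.PneNP.Theorems.ConvexRankGatesConvexGateBlindCollapseMain
import Summits.PneNP.PneNP.Theorems.ConvexRankGatesConvexGateBlindFactorisation

/-!
# PneNP / ConvexRankGates — `ConvexGateBlind`, line `xor-door-perfect-completeness`: the canonical (cone-rank) form of `C⁺`

Helper file for the crux `ConvexGateBlind` (item `stmt-PneNP-10680`, `--supports`; closes nothing by
itself). It proves the stub `stub_xorCanonical : XorConeRankHardEv → Xor3UnsatConvBlind` of the line: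
the XOR transcription of the kernel-checked canonical form of the crux
(`convGate_cliqueDist_coneFactorisation`, `convDataHard_iff_cliqueDistConeRankHard` (←) for CLIQUE).
If for every `c`, eventually in `n`, for every `ε > 0` the shifted one-sided distance matrix
`(u, v) ↦ #(v ∖ u) - ε` (rows: satisfiable = rejected systems `u`, columns: unsatisfiable = accepted
systems `v` of the 3XOR pool) has no `(PSD_q ⊕ ℝ^r_{≥0})`-factorisation with `q + r ≤ n^c`, then no
polynomial `{∧₂, ∨₂} ∪ CONV` circuit computes `3XOR-UNSAT_n`.

The heart is GENERIC (any finite input type `ι`, any Boolean function `g`):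
* `convData_dist_coneFactorisation`: CONV data `(A, b, B ≥ 0)` computing `g` exactly give some `ε > 0`
  and a factorisation `#(x ∖ u) - ε = tr(H_u Y_x) + ∑_l U_{u,l} V_{l,x}` (`g u = 0`, `g x = 1`) with
  `H_u, Y_x ⪰ 0` (`q × q`) and `U, V ≥ 0` over `L = (Fin p ⊕ 1) ⊕ ((ι ⊕ ι) ⊕ 1)`. From the trace-normalised
  Farkas certificates of `convGate_certificate_factorisation` (`w_u = Bᵀ y_u ≥ 0`, `w_u · u < θ_u`,
  `w_u · x - θ_u = tr(H_u Y_x) + y_u · s_x + λ_u t_x`): put `W_u = 1 + ∑ w_u`, `ε_u = (θ_u - w_u · u) / W_u > 0`,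
  `ε = min_u ε_u`, and use the identity
  `W_u #(x ∖ u) - (θ_u - w_u · u) = (w_u · x - θ_u) + ∑_{e ∉ u} (W_u - w_u(e)) [x_e] + ∑_{e ∈ u} w_u(e) [¬ x_e]`;
  the excess `ε_u - ε ≥ 0` is one more non-negative rank-one term;
* `hasConeFact_dist_of_convData`: the same as a `HasConeFact` over `Fin r`, `r = p + 1 + (2 #ι + 1)`;
* `convData_of_wiredConvGate`: the wiring of a CONV gate is absorbed into the input coefficients
  (`B i e = ∑_{a : w a = e} B' i a ≥ 0`).
Assembly (`stub_xorCanonical`): collapse the circuit to ONE CONV gate (`exists_oneConvGate_of_isOver`,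
width `4 (n^c + 3) (t + 2n³ + 1)²`), rewire, factorise, and bound `q + r ≤ n^{5(c+4)}` for `n ≥ 2`
(`xorCanonical_size_le_pow`). [folklore: Yannakakis 1991; Gouveia–Parrilo–Thomas 2013, Thm. 1;
Hrubeš 2020, Thm. 20 — SDP / XOR transcription]
-/

set_option linter.dupNamespace false -- `Summit.PneNP.PneNP.…`: summit = sub-problem (D-0017)

namespace Summit.PneNP.PneNP.Theorems.XorDoor

open Filter Finset Matrix Literature.Computability.Complexity

/-! ## §1 CONV data computing `g` factorise the distance matrix `#(x ∖ u) - ε` through `PSD_q ⊕ ℝ₊` -/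

/-- **CONV data computing `g` factorise `D - εJ` through `PSD_q ⊕ ℝ₊`** (`D[u,x] = #(x ∖ u)`, generic in the
finite input type `ι` and the Boolean function `g`). If `g x = 1 ↔ ∃ Z ⪰ 0, tr(Aᵢ Z) ≤ bᵢ + ∑ₑ Bᵢₑ [xₑ]`
(`B ≥ 0`), then for some `ε > 0` there are `H_u ⪰ 0` (`g u = 0`), `Y_x ⪰ 0` (`g x = 1`) and non-negative
`U, V` over `(Fin p ⊕ Unit) ⊕ ((ι ⊕ ι) ⊕ Unit)` with `#(x ∖ u) - ε = tr(H_u Y_x) + ∑_l U_{u,l} V_{l,x}`.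
(Transcription of `convGate_cliqueDist_coneFactorisation`: `W_u = 1 + ∑ w_u`, `H'_u = W_u⁻¹ H_u`,
`ε_u = (θ_u - w_u · u) / W_u`, `ε = min_u ε_u`.) [folklore] -/
theorem convData_dist_coneFactorisation {ι : Type*} [Fintype ι] {p q : ℕ} (g : (ι → Bool) → Bool)
    (A : Fin p → Matrix (Fin q) (Fin q) ℝ) (b : Fin p → ℝ) (B : Fin p → ι → ℝ) (hB : ∀ i e, 0 ≤ B i e)
    (hcomp : ∀ x : ι → Bool, g x = true ↔
      ∃ Z : Matrix (Fin q) (Fin q) ℝ, Z.PosSemidef ∧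
        ∀ i, (A i * Z).trace ≤ b i + ∑ e, B i e * (if x e then (1 : ℝ) else 0)) :
    ∃ ε : ℝ, 0 < ε ∧
      ∃ (H : (ι → Bool) → Matrix (Fin q) (Fin q) ℝ) (Y : (ι → Bool) → Matrix (Fin q) (Fin q) ℝ)
        (U : (ι → Bool) → ((Fin p ⊕ Unit) ⊕ ((ι ⊕ ι) ⊕ Unit)) → ℝ)
        (V : ((Fin p ⊕ Unit) ⊕ ((ι ⊕ ι) ⊕ Unit)) → (ι → Bool) → ℝ),
        (∀ u, g u = false → (H u).PosSemidef) ∧ (∀ x, g x = true → (Y x).PosSemidef) ∧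
        (∀ u, g u = false → ∀ l, 0 ≤ U u l) ∧ (∀ x, g x = true → ∀ l, 0 ≤ V l x) ∧
        ∀ u x, g u = false → g x = true →
          (∑ e, if x e = true ∧ u e = false then (1 : ℝ) else 0) - ε =
            (H u * Y x).trace + ∑ l, U u l * V l x := by
  classical
  -- adapted from Theorems/ConvexRankGatesConvexGateBlindCliqueDistanceSdp.lean
  obtain ⟨R, y, lam, w, θ, H, Y, s, t, -, -, -, -, hrej, hacc⟩ :=
    convGate_certificate_factorisation A b B hB
  -- rejected inputs are infeasible, accepted inputs are feasible
  have hrej' : ∀ u : ι → Bool, g u = false →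
      ¬ ∃ Z : Matrix (Fin q) (Fin q) ℝ, Z.PosSemidef ∧
        ∀ i, (A i * Z).trace ≤ b i + ∑ e, B i e * (if u e then (1 : ℝ) else 0) := by
    intro u hu hZ
    have h := (hcomp u).2 hZ
    rw [hu] at h
    exact Bool.noConfusion h
  have hacc' : ∀ x : ι → Bool, g x = true → ∃ Z : Matrix (Fin q) (Fin q) ℝ, Z.PosSemidef ∧
      ∀ i, (A i * Z).trace ≤ b i + ∑ e, B i e * (if x e then (1 : ℝ) else 0) :=
    fun x hx => (hcomp x).1 hx
  -- derived data
  let W : (ι → Bool) → ℝ := fun u => 1 + ∑ e, w u e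
  let εu : (ι → Bool) → ℝ := fun u => (θ u - ∑ e, w u e * (if u e then (1 : ℝ) else 0)) / W u
  have hw0 : ∀ u, g u = false → ∀ e, 0 ≤ w u e := fun u hu e => (hrej u (hrej' u hu)).2.2.1 e
  have hW : ∀ u, g u = false → 0 < W u := by
    intro u hu
    have : 0 ≤ ∑ e, w u e := Finset.sum_nonneg fun e _ => hw0 u hu e
    simp only [W]
    linarith
  have hwW : ∀ u, g u = false → ∀ e, w u e ≤ W u := by
    intro u hu e
    have : w u e ≤ ∑ e, w u e := Finset.single_le_sum (fun e _ => hw0 u hu e) (Finset.mem_univ e)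
    simp only [W]
    linarith
  have hεu : ∀ u, g u = false → 0 < εu u := by
    intro u hu
    have h := (hrej u (hrej' u hu)).2.2.2.2
    exact div_pos (by linarith) (hW u hu)
  -- the uniform margin (`ε = 1` if nothing is rejected)
  have hε : ∃ ε : ℝ, 0 < ε ∧ ∀ u, g u = false → ε ≤ εu u := by
    by_cases hex : ∃ u : ι → Bool, g u = false
    · have hne : (univ.filter fun u : ι → Bool => g u = false).Nonempty := by
        obtain ⟨u, hu⟩ := hex
        exact ⟨u, Finset.mem_filter.2 ⟨Finset.mem_univ _, hu⟩⟩
      obtain ⟨u₀, hu₀, hmin⟩ := Finset.exists_min_image _ εu hne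
      exact ⟨εu u₀, hεu u₀ (Finset.mem_filter.1 hu₀).2, fun u hu =>
        hmin u (Finset.mem_filter.2 ⟨Finset.mem_univ _, hu⟩)⟩
    · exact ⟨1, one_pos, fun u hu => absurd ⟨u, hu⟩ hex⟩
  obtain ⟨ε, hε0, hεle⟩ := hε
  refine ⟨ε, hε0, ?_⟩
  -- the factors
  let Hf : (ι → Bool) → Matrix (Fin q) (Fin q) ℝ := fun u => (1 / W u) • H u
  let Uf : (ι → Bool) → ((Fin p ⊕ Unit) ⊕ ((ι ⊕ ι) ⊕ Unit)) → ℝ := fun u => Sum.elim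
      (Sum.elim (fun i => y u i / W u) (fun _ => lam u / W u))
      (Sum.elim (Sum.elim (fun e => if u e then 0 else (W u - w u e) / W u)
        (fun e => if u e then w u e / W u else 0)) (fun _ => εu u - ε))
  let Vf : ((Fin p ⊕ Unit) ⊕ ((ι ⊕ ι) ⊕ Unit)) → (ι → Bool) → ℝ := fun l x => Sum.elim
      (Sum.elim (fun i => s x i) (fun _ => t x))
      (Sum.elim (Sum.elim (fun e => if x e then (1 : ℝ) else 0)
        (fun e => if x e then (0 : ℝ) else 1)) (fun _ => 1)) l
  refine ⟨Hf, Y, Uf, Vf, fun u hu => ?_, fun x hx => (hacc _ (hacc' x hx)).1, fun u hu l => ?_,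
    fun x hx l => ?_, fun u x hu hx => ?_⟩
  · exact (hrej u (hrej' u hu)).2.2.2.1.smul (by have := hW u hu; positivity)
  · rcases l with (i | _) | ((e | e) | _)
    · exact div_nonneg ((hrej u (hrej' u hu)).1 i) (hW u hu).le
    · exact div_nonneg (hrej u (hrej' u hu)).2.1 (hW u hu).le
    · simp only [Uf, Sum.elim_inl, Sum.elim_inr]
      split_ifs
      · exact le_rfl
      · exact div_nonneg (by linarith [hwW u hu e]) (hW u hu).le
    · simp only [Uf, Sum.elim_inl, Sum.elim_inr]
      split_ifs
      · exact div_nonneg (hw0 u hu e) (hW u hu).le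
      · exact le_rfl
    · simp only [Uf, Sum.elim_inr, sub_nonneg]
      exact hεle u hu
  · rcases l with (i | _) | ((e | e) | _)
    · exact (hacc _ (hacc' x hx)).2.2.1 i
    · exact (hacc _ (hacc' x hx)).2.2.2.1
    · simp only [Vf, Sum.elim_inl, Sum.elim_inr]
      split_ifs <;> norm_num
    · simp only [Vf, Sum.elim_inl, Sum.elim_inr]
      split_ifs <;> norm_num
    · simp only [Vf, Sum.elim_inr]
      norm_num
  · -- the identity `#(x ∖ u) - ε = tr(H' Y) + ∑ U V`
    have hWpos := hW u hu
    have hWne : W u ≠ 0 := hWpos.ne'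
    have hdual := (hacc _ (hacc' x hx)).2.2.2.2.2.2 u
    simp only [Hf, Uf, Vf, Fintype.sum_sum_type, Sum.elim_inl, Sum.elim_inr,
      Finset.univ_unique, Finset.sum_singleton, Matrix.smul_mul, Matrix.trace_smul, smul_eq_mul]
    -- first block: weak duality made exact
    have S1 : 1 / W u * (H u * Y x).trace + (∑ i, y u i / W u * s x i + lam u / W u * t x) =
        (∑ e, w u e * (if x e then (1 : ℝ) else 0) - θ u) / W u := by
      rw [hdual]
      simp only [add_div, Finset.sum_div]
      have : ∑ i, y u i / W u * s x i = ∑ i, y u i * s x i / W u :=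
        Finset.sum_congr rfl fun i _ => by ring
      rw [this]
      ring
    -- second block: position by position
    have S2 : ∀ e : ι, (if u e then 0 else (W u - w u e) / W u) * (if x e then (1 : ℝ) else 0) +
        (if u e then w u e / W u else 0) * (if x e then (0 : ℝ) else 1) =
        (W u * (if x e = true ∧ u e = false then (1 : ℝ) else 0)
          - w u e * (if x e then (1 : ℝ) else 0) + w u e * (if u e then (1 : ℝ) else 0)) / W u := by
      intro e
      cases u e <;> cases x e <;> simp
    have S2sum : ∑ e, ((if u e then 0 else (W u - w u e) / W u) * (if x e then (1 : ℝ) else 0)) +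
        ∑ e, ((if u e then w u e / W u else 0) * (if x e then (0 : ℝ) else 1)) =
        (W u * (∑ e, if x e = true ∧ u e = false then (1 : ℝ) else 0)
          - ∑ e, w u e * (if x e then (1 : ℝ) else 0) + ∑ e, w u e * (if u e then (1 : ℝ) else 0)) / W u := by
      rw [← Finset.sum_add_distrib, Finset.sum_congr rfl fun e _ => S2 e, ← Finset.sum_div,
        Finset.sum_add_distrib, Finset.sum_sub_distrib, Finset.mul_sum]
    have hgoal : 1 / W u * (H u * Y x).trace +
        (∑ i, y u i / W u * s x i + lam u / W u * t x +
          ((∑ e, ((if u e then 0 else (W u - w u e) / W u) * (if x e then (1 : ℝ) else 0)) +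
              ∑ e, ((if u e then w u e / W u else 0) * (if x e then (0 : ℝ) else 1))) +
            (εu u - ε) * 1)) =
        (∑ e, if x e = true ∧ u e = false then (1 : ℝ) else 0) - ε := by
      rw [S2sum, mul_one, ← add_assoc, ← add_assoc, S1]
      simp only [εu]
      field_simp
      ring
    linarith [hgoal]

/-- **`HasConeFact` form.** CONV data `(A, b, B ≥ 0)` with `p` rows and a `q × q` matrix variable computing
`g` exactly give some `ε > 0` such that the matrix `(u, x) ↦ #(x ∖ u) - ε` over
`{u // g u = 0} × {x // g x = 1}` has a `(PSD_q ⊕ ℝ^r_{≥0})`-factorisation with `r = p + 1 + (2 #ι + 1)`.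
[folklore] -/
theorem hasConeFact_dist_of_convData {ι : Type} [Fintype ι] {p q : ℕ} (g : (ι → Bool) → Bool)
    (A : Fin p → Matrix (Fin q) (Fin q) ℝ) (b : Fin p → ℝ) (B : Fin p → ι → ℝ) (hB : ∀ i e, 0 ≤ B i e)
    (hcomp : ∀ x : ι → Bool, g x = true ↔
      ∃ Z : Matrix (Fin q) (Fin q) ℝ, Z.PosSemidef ∧
        ∀ i, (A i * Z).trace ≤ b i + ∑ e, B i e * (if x e then (1 : ℝ) else 0)) :
    ∃ ε : ℝ, 0 < ε ∧ HasConeFact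
      (fun (u : {u : ι → Bool // g u = false}) (x : {x : ι → Bool // g x = true}) =>
        (∑ e, if x.1 e = true ∧ u.1 e = false then (1 : ℝ) else 0) - ε)
      q (p + 1 + (Fintype.card ι + Fintype.card ι + 1)) := by
  classical
  obtain ⟨ε, hε, H, Y, U, V, hH, hY, hU, hV, hfact⟩ := convData_dist_coneFactorisation g A b B hB hcomp
  have hcardL : Fintype.card ((Fin p ⊕ Unit) ⊕ ((ι ⊕ ι) ⊕ Unit)) =
      p + 1 + (Fintype.card ι + Fintype.card ι + 1) := by
    simp only [Fintype.card_sum, Fintype.card_fin, Fintype.card_unique]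
  set eL := Fintype.equivFinOfCardEq hcardL with heL
  refine ⟨ε, hε, fun u => H u.1, fun x => Y x.1, fun u i => U u.1 (eL.symm i), fun i x => V (eL.symm i) x.1,
    fun u => hH u.1 u.2, fun x => hY x.1 x.2, fun u i => hU u.1 u.2 _, fun i x => hV x.1 x.2 _,
    fun u x => ?_⟩
  dsimp only
  rw [hfact u.1 x.1 u.2 x.2, ← Equiv.sum_comp eL.symm (fun l => U u.1 l * V l x.1)]

/-! ## §2 Absorbing the wiring of a CONV gate -/

/-- **Wiring is free.** If a CONV gate `g` of size parameter `S`, wired by `w` to the input positions `ι`,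
computes `f`, then some CONV data on `ι` with the same `p + q ≤ S` compute `f`: push the input
coefficients forward along the wiring, `B i e = ∑_{a : w a = e} B' i a ≥ 0`. [folklore] -/
theorem convData_of_wiredConvGate {ι : Type*} [Fintype ι] {S : ℕ} {g : GateFn} (hg : IsConvGate S g)
    (w : Fin g.1 → ι) (f : (ι → Bool) → Bool) (hcomp : ∀ x : ι → Bool, g.2 (fun a => x (w a)) = f x) :
    ∃ p q : ℕ, p + q ≤ S ∧ ∃ (A : Fin p → Matrix (Fin q) (Fin q) ℝ) (b : Fin p → ℝ) (B : Fin p → ι → ℝ),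
      (∀ i e, 0 ≤ B i e) ∧ ∀ x : ι → Bool, f x = true ↔
        ∃ Y : Matrix (Fin q) (Fin q) ℝ, Y.PosSemidef ∧
          ∀ i, (A i * Y).trace ≤ b i + ∑ e, B i e * (if x e then (1 : ℝ) else 0) := by
  classical
  -- adapted from `oneGateHard_iff_dataHard` (Theorems/ConvexRankGatesConvexGateBlindRankForm.lean)
  obtain ⟨p, q, hpq, A, b, B', hB', hiff⟩ := hg
  let B : Fin p → ι → ℝ := fun i e => ∑ a ∈ univ.filter (fun a : Fin g.1 => w a = e), B' i a
  have hB : ∀ i e, 0 ≤ B i e := fun i e => Finset.sum_nonneg fun a _ => hB' i a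
  have hkey : ∀ (x : ι → Bool) (i : Fin p),
      (∑ a, B' i a * (if x (w a) then (1 : ℝ) else 0)) = ∑ e, B i e * (if x e then (1 : ℝ) else 0) := by
    intro x i
    have hind : ∀ a : Fin g.1, (if x (w a) then (1 : ℝ) else 0) =
        ∑ e, if w a = e then (if x e then (1 : ℝ) else 0) else 0 := fun a => by
      rw [Finset.sum_ite_eq]; simp
    simp_rw [hind, Finset.mul_sum, B, Finset.sum_mul]
    rw [Finset.sum_comm]
    refine Finset.sum_congr rfl fun e _ => ?_
    rw [Finset.sum_filter]
    refine Finset.sum_congr rfl fun a _ => ?_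
    split_ifs <;> simp
  refine ⟨p, q, hpq, A, b, B, hB, fun x => ?_⟩
  rw [← hcomp x, hiff]
  simp_rw [hkey]

/-! ## §3 Size bookkeeping and the stub -/

/-- Size bookkeeping: for `n ≥ 2`, `t ≤ n^c` gates, `N = 2n³` inputs and
`p + q ≤ 4 (n^c + 3) (t + N + 1)²`, the rank `q + (p + 1 + (2N + 1))` is at most `n^{5(c+4)}`. [folklore] -/
theorem xorCanonical_size_le_pow {n c t N p q : ℕ} (hn : 2 ≤ n) (ht : t ≤ n ^ c) (hN : N = 2 * n ^ 3)
    (hpq : p + q ≤ 4 * (n ^ c + 3) * (t + N + 1) ^ 2) :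
    q + (p + 1 + (N + N + 1)) ≤ n ^ ((c + 4) * 5) := by
  set M := n ^ (c + 4) with hM
  have hc1 : 1 ≤ n ^ c := Nat.one_le_pow _ _ (by omega)
  have hn3 : 1 ≤ n ^ 3 := Nat.one_le_pow _ _ (by omega)
  have hn4 : 16 ≤ n ^ 4 := by
    calc 16 = 2 ^ 4 := by norm_num
      _ ≤ n ^ 4 := Nat.pow_le_pow_left hn 4
  have hMeq : M = n ^ c * n ^ 4 := pow_add n c 4
  have h44 : n ^ 4 = n ^ 3 * n := pow_succ n 3
  have hM16 : 16 ≤ M := by rw [hMeq]; nlinarith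
  have hcM : n ^ c ≤ M := by rw [hMeq]; nlinarith
  have hNM : N ≤ M := by rw [hN, hMeq]; nlinarith
  have h3 : t + N + 1 ≤ 3 * M := by omega
  have hW : 4 * (n ^ c + 3) * (t + N + 1) ^ 2 ≤ 4 * (2 * M) * (3 * M) ^ 2 :=
    Nat.mul_le_mul (Nat.mul_le_mul_left 4 (by omega)) (Nat.pow_le_pow_left h3 2)
  have e1 : 4 * (2 * M) * (3 * M) ^ 2 = 72 * M ^ 3 := by ring
  have hM3 : M ≤ M ^ 3 := Nat.le_self_pow (by norm_num) M
  have hM5 : 75 * M ^ 3 ≤ M ^ 5 := by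
    have h2 : 16 ^ 2 ≤ M ^ 2 := Nat.pow_le_pow_left hM16 2
    calc 75 * M ^ 3 ≤ M ^ 2 * M ^ 3 := Nat.mul_le_mul_right _ (by norm_num at h2; omega)
      _ = M ^ 5 := by rw [← pow_add]
  rw [pow_mul, ← hM]
  omega

/-- **The stub `stub_xorCanonical` (canonical form of `C⁺`, XOR transcription).** If for every `c`,
eventually in `n`, for every `ε > 0` the matrix `(u, v) ↦ #(v ∖ u) - ε` over satisfiable `u` × unsatisfiable
`v` has no `(PSD_q ⊕ ℝ^r_{≥0})`-factorisation with `q + r ≤ n^c`, then `3XOR-UNSAT` is CONV-blind: a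
`{∧₂, ∨₂} ∪ CONV_{n^c}` circuit of size `≤ n^c` computing `3XOR-UNSAT_n` collapses to one CONV gate
(`exists_oneConvGate_of_isOver`), whose data factorise `#(v ∖ u) - ε` with `q + r ≤ n^{5(c+4)}`
(`hasConeFact_dist_of_convData`), contradicting `XorConeRankHard n (5(c+4))`. [folklore] -/
theorem stub_xorCanonical : XorConeRankHardEv → Xor3UnsatConvBlind := by
  intro hHard c
  filter_upwards [hHard ((c + 4) * 5), Filter.eventually_ge_atTop 2] with n hn hn2
  intro C hC hCsize hcomp
  -- collapse to one CONV gate, absorb the wiring, factorise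
  obtain ⟨g₀, hg₀, w, hw⟩ := exists_oneConvGate_of_isOver (s := n ^ c) C hC
  obtain ⟨p, q, hpq, A, b, B, hB, hiff⟩ :=
    convData_of_wiredConvGate hg₀ w (xor3Unsat n) fun x => (hw x).trans (hcomp x)
  obtain ⟨ε, hε, hfact⟩ := hasConeFact_dist_of_convData (xor3Unsat n) A b B hB hiff
  -- size bookkeeping
  have hN : Fintype.card (Pool n) = 2 * n ^ 3 := by
    simp only [Fintype.card_prod, Fintype.card_fin, ZMod.card]
    ring
  have hsize : q + (p + 1 + (Fintype.card (Pool n) + Fintype.card (Pool n) + 1)) ≤ n ^ ((c + 4) * 5) :=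
    xorCanonical_size_le_pow hn2 hCsize hN hpq
  exact hn ε hε q _ hsize hfact

end Summit.PneNP.PneNP.Theorems.XorDoor
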